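import Mathlib
import HarnessLib
import Literature.Barriers.CriticalPhenomena.PositionSpaceRGNonGibbsianChessboard
import Summits.QuantumFields.YangMills.Theorems.LangevinControlUVFemtoCurvatureTwoPointStubPlaquetteProductRPCSHelpers

/-!
# Crux `FemtoCurvatureTwoPoint` (stmt-QuantumFields-9363, route `LangevinControlUV`):
# stub RPCS — reflection Cauchy–Schwarz for products of `01`-plaquette observables

Helper for the line `generic-step-gamma-encoding` (`--supports stmt-QuantumFields-9363`), closing
the registered stub `stub_plaquetteProductRPCS` verbatim: on an even torus `(ℤ/L)⁴`, for every
compact group `G`, continuous matrix representation `ρ`, `β ≥ 0`, every bounded measurable `f ≥ 0`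
and `ψ(S) = E_{L,β}[∏_{x ∈ S} f(N − Re tr ρ(U_{(x;0,1)}))]` (`S` a set of base points of
`01`-plaquettes, i.e. of cells of the block torus `(ℤ/L)⁴` of the tree's chessboard file
`PositionSpaceRGNonGibbsianChessboard`),

  `ψ(S)² ≤ ψ(symP i k S) · ψ(symM i k S)`  for every direction `i : Fin 4` and every `k : ℤ/L`,

the reflection-positivity input of the chessboard estimate (Fröhlich–Israel–Lieb–Simon 1978,
Thm. 2.2; Friedli–Velenik, Thm. 10.11). Here `symP i k S = (S ∩ H₊) ∪ θ(S ∩ H₊)` and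
`symM i k S = (S ∩ H₋) ∪ θ(S ∩ H₋)` for the cell reflection `θ = cellReflect i k`,
`xᵢ ↦ 2k − 1 − xᵢ`, and the halves `H₊ = {(xᵢ − k).val < L/2}`, `H₋ = {L/2 ≤ (xᵢ − k).val}`.

Proof. The helpers file (`…StubPlaquetteProductRPCSHelpers`, `prod_rp_cauchySchwarz`) reduces the
claim to the existence of a measurable measure-preserving involution `Θ` of the configuration space,
reflection positive on a cone of observables containing the products of cell observables over
subsets of `H₊`, with `Re tr ρ((ΘU)_{(x;0,1)}) = Re tr ρ(U_{(θx;0,1)})`. For the two directions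
`i ∈ {2, 3}` transverse to the `01`-plane this is the LINK reflection `xᵢ ↦ 2k − 1 − xᵢ` (the tree's
`GaugeConfig.timeReflect` transported to axis `i` by the axis swap `(0 i)` and to the hyperplane `k`
by the translation `(k − 1)eᵢ`); for the two in-plane directions `i ∈ {0, 1}` it is the SITE
reflection `xᵢ ↦ 2k − xᵢ` (the tree's `GaugeConfig.negReflect` transported by `(0 i)` and `k eᵢ`),
which maps the plaquette based at `x` (spanning `xᵢ, xᵢ + 1`) onto the plaquette based at `θx`
with reversed orientation, `Re tr` being insensitive to the orientation. The positive half of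
either reflection contains the four links of every `01`-plaquette based in `H₊`.
-/

noncomputable section

open scoped BigOperators Matrix
open MeasureTheory Filter Topology ProbabilityTheory
open Literature.MathematicalPhysics.QuantumFieldTheory
open Literature.Barriers.CriticalPhenomena.NonGibbs (symP symM)

namespace Summit.QuantumFields.YangMills.Theorems.FemtoCurvatureTwoPoint.PlaquetteProductRPCS

open Literature.Barriers.CriticalPhenomena.NonGibbs

section Plaquettes

variable {L N : ℕ} [NeZero L] {G : Type*} [Group G] [TopologicalSpace G]
  [IsTopologicalGroup G] [CompactSpace G] [MeasurableSpace G] [BorelSpace G]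
  (ρ : G →* Matrix (Fin N) (Fin N) ℂ)

omit [NeZero L] in
/-- `swap 0 i j = 0 ↔ j = i`. [folklore] -/
theorem swap_zero_apply_eq_zero_iff {d : ℕ} [NeZero d] (i j : Fin d) :
    Equiv.swap (0 : Fin d) i j = 0 ↔ j = i := by
  rw [Equiv.swap_apply_eq_iff, Equiv.swap_apply_left]

omit [NeZero L] [TopologicalSpace G] [IsTopologicalGroup G] [CompactSpace G] [BorelSpace G] in
/-- **Transverse directions**: for `i ∉ {0, 1}` the LINK reflection transported by the axis swap
`(0 i)` and the translation `(k−1)eᵢ` maps the `01`-plaquette holonomy at `x` to the one at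
`cellReflect i k x = x[i ↦ 2k − 1 − xᵢ]`. [folklore] -/
theorem plaquetteHolonomy_linkTheta {i : Fin 4} (hi0 : i ≠ 0) (hi1 : i ≠ 1) (k : ZMod L)
    (U : GaugeConfig 4 L G) (x : Site 4 L) :
    plaquetteHolonomy (torusConfigShift (Pi.single i (k - 1)) (configPerm (Equiv.swap 0 i)
      (GaugeConfig.timeReflect (configPerm (Equiv.swap 0 i).symm
        (torusConfigShift (-Pi.single i (k - 1)) U))))) x 0 1 =
      plaquetteHolonomy U (cellReflect i k x) 0 1 := by
  have h1 : Equiv.swap (0 : Fin 4) i 1 ≠ 0 := by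
    rw [Ne, swap_zero_apply_eq_zero_iff]; exact fun h => hi1 h.symm
  simp only [plaquetteHolonomy_torusConfigShift, plaquetteHolonomy_configPerm, Equiv.symm_swap,
    Equiv.swap_apply_left, plaquetteHolonomy_timeReflect_of_ne _ _ hi0 h1,
    Equiv.swap_apply_right, Equiv.swap_apply_self]
  congr 1
  funext j
  by_cases hj : j = i
  · subst hj
    simp only [sitePerm_apply, Equiv.symm_swap, Equiv.swap_apply_right, Pi.sub_apply, Pi.neg_apply,
      WilsonRP.timeReflect_apply_zero, Equiv.swap_apply_left, Pi.single_eq_same, cellReflect_apply,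
      Function.update_self]
    ring
  · have hm : Equiv.swap (0 : Fin 4) i j ≠ 0 := by
      rw [Ne, swap_zero_apply_eq_zero_iff]; exact hj
    rw [Pi.sub_apply, Pi.neg_apply, sitePerm_apply, Equiv.symm_swap,
      WilsonRP.timeReflect_apply_of_ne _ hm, sitePerm_apply, Equiv.symm_swap, Equiv.swap_apply_self]
    simp [hj]

omit [NeZero L] [BorelSpace G] in
/-- **In-plane directions**: for `i ∈ {0, 1}` the SITE reflection transported by `(0 i)` and `k eᵢ`
maps `Re tr` of the `01`-plaquette holonomy at `x` to the one at `cellReflect i k x` (the reflected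
plaquette has the reversed orientation). [folklore] -/
theorem re_tr_plaquetteHolonomy_siteTheta (hρ : Continuous ρ) {i : Fin 4} (h01 : i = 0 ∨ i = 1)
    (k : ZMod L) (U : GaugeConfig 4 L G) (x : Site 4 L) :
    (ρ (plaquetteHolonomy (torusConfigShift (Pi.single i k) (configPerm (Equiv.swap 0 i)
      (GaugeConfig.negReflect (configPerm (Equiv.swap 0 i).symm
        (torusConfigShift (-Pi.single i k) U))))) x 0 1)).trace.re =
      (ρ (plaquetteHolonomy U (cellReflect i k x) 0 1)).trace.re := by
  have hab : (i = 0 ∧ Equiv.swap (0 : Fin 4) i 1 ≠ 0) ∨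
      (Equiv.swap (0 : Fin 4) i 1 = 0 ∧ i ≠ 0) := by
    rcases h01 with rfl | rfl
    · left; decide
    · right; decide
  simp only [plaquetteHolonomy_torusConfigShift, plaquetteHolonomy_configPerm, Equiv.symm_swap,
    Equiv.swap_apply_left]
  rw [re_tr_plaquetteHolonomy_negReflect_temporal ρ hρ _ _ hab]
  simp only [plaquetteHolonomy_configPerm, Equiv.symm_swap, Equiv.swap_apply_right,
    Equiv.swap_apply_self, plaquetteHolonomy_torusConfigShift]
  have hz : sitePerm (Equiv.swap (0 : Fin 4) i)
      (((sitePerm (Equiv.swap (0 : Fin 4) i)) (x - Pi.single i k)).shift 0).negReflect -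
        -Pi.single i k = cellReflect i k x := by
    funext j
    by_cases hj : j = i
    · subst hj
      simp only [sitePerm_apply, Equiv.symm_swap, Equiv.swap_apply_right, Pi.sub_apply,
        Pi.neg_apply, WilsonSiteRP.negReflect_apply_zero, WilsonRP.shift_apply_self,
        Equiv.swap_apply_left, Pi.single_eq_same, cellReflect_apply, Function.update_self]
      ring
    · have hm : Equiv.swap (0 : Fin 4) i j ≠ 0 := by
        rw [Ne, swap_zero_apply_eq_zero_iff]; exact hj
      rw [Pi.sub_apply, Pi.neg_apply, sitePerm_apply, Equiv.symm_swap,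
        WilsonSiteRP.negReflect_apply_of_ne _ hm, WilsonRP.shift_apply_of_ne _ hm, sitePerm_apply,
        Equiv.symm_swap, Equiv.swap_apply_self]
      simp [hj]
  rw [hz]

omit [TopologicalSpace G] [IsTopologicalGroup G] [CompactSpace G] [MeasurableSpace G]
  [BorelSpace G] in
/-- **Transverse directions, admissibility**: for `i ∉ {0, 1}` and a cell `x` of the positive half
`(xᵢ − k).val < L/2`, every function of the `01`-plaquette holonomy at `x` depends only on links
whose pull-back by `Φ = τ_{(k−1)eᵢ} ∘ (0 i)_*` is a positive-time link. [folklore] -/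
theorem dependsOn_plaq01_link (hL : Even L) {i : Fin 4} (hi0 : i ≠ 0) (hi1 : i ≠ 1) {k : ZMod L}
    {x : Site 4 L} (hx : x ∈ halfPlus L i k) (φ : G → ℝ) :
    DependsOn (fun U : GaugeConfig 4 L G => φ (plaquetteHolonomy U x 0 1))
      {e : Edge 4 L | WilsonRP.IsPosEdge
        ((sitePerm (Equiv.swap 0 i).symm (e.1 - Pi.single i (k - 1)), (Equiv.swap 0 i).symm e.2) :
          Edge 4 L)} := by
  haveI : Fact (1 < L) := ⟨by obtain ⟨r, hr⟩ := hL; have := NeZero.ne L; omega⟩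
  rw [mem_halfPlus] at hx
  obtain ⟨r, hr⟩ := hL
  have hval : (x i - (k - 1)).val = (x i - k).val + 1 := by
    rw [show x i - (k - 1) = (x i - k) + 1 by ring, ZMod.val_add, ZMod.val_one, Nat.mod_eq_of_lt]
    omega
  -- each of the four links of the plaquette is a positive-time link after pull-back
  have hedge : ∀ (y : Site 4 L) (a : Fin 4), y i = x i → (a = 0 ∨ a = 1) →
      WilsonRP.IsPosEdge ((sitePerm (Equiv.swap 0 i).symm (y - Pi.single i (k - 1)),
        (Equiv.swap 0 i).symm a) : Edge 4 L) := by
    intro y a hy ha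
    have ha0 : (Equiv.swap (0 : Fin 4) i).symm a ≠ 0 := by
      rw [Equiv.symm_swap, Ne, swap_zero_apply_eq_zero_iff]
      rcases ha with rfl | rfl
      · exact fun h => hi0 h.symm
      · exact fun h => hi1 h.symm
    have ht : (sitePerm (Equiv.swap (0 : Fin 4) i).symm (y - Pi.single i (k - 1))) 0 =
        x i - (k - 1) := by
      simp [sitePerm_apply, hy]
    simp only [WilsonRP.IsPosEdge, WilsonRP.shift_apply_of_ne _ ha0.symm, ht, hval]
    omega
  intro U V hUV
  simp only [plaquetteHolonomy]
  rw [hUV (x, 0) (hedge x 0 rfl (Or.inl rfl)),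
    hUV (x.shift 0, 1) (hedge _ 1 (WilsonRP.shift_apply_of_ne _ hi0) (Or.inr rfl)),
    hUV (x.shift 1, 0) (hedge _ 0 (WilsonRP.shift_apply_of_ne _ hi1) (Or.inl rfl)),
    hUV (x, 1) (hedge x 1 rfl (Or.inr rfl))]

omit [TopologicalSpace G] [IsTopologicalGroup G] [CompactSpace G] [MeasurableSpace G]
  [BorelSpace G] in
/-- **In-plane directions, admissibility**: for `i ∈ {0, 1}` and a cell `x` of the positive half,
every function of the `01`-plaquette holonomy at `x` depends only on links whose pull-back by
`Φ = τ_{k eᵢ} ∘ (0 i)_*` is a site-positive or shared link. [folklore] -/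
theorem dependsOn_plaq01_site (hL : Even L) {i : Fin 4} (h01 : i = 0 ∨ i = 1) {k : ZMod L}
    {x : Site 4 L} (hx : x ∈ halfPlus L i k) (φ : G → ℝ) :
    DependsOn (fun U : GaugeConfig 4 L G => φ (plaquetteHolonomy U x 0 1))
      {e : Edge 4 L |
        WilsonSiteRP.IsSitePosEdge ((sitePerm (Equiv.swap 0 i).symm (e.1 - Pi.single i k),
          (Equiv.swap 0 i).symm e.2) : Edge 4 L) ∨
        WilsonSiteRP.IsSharedEdge ((sitePerm (Equiv.swap 0 i).symm (e.1 - Pi.single i k),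
          (Equiv.swap 0 i).symm e.2) : Edge 4 L)} := by
  haveI : Fact (1 < L) := ⟨by obtain ⟨r, hr⟩ := hL; have := NeZero.ne L; omega⟩
  rw [mem_halfPlus] at hx
  obtain ⟨r, hr⟩ := hL
  have hval : (x i + 1 - k).val = (x i - k).val + 1 := by
    rw [show x i + 1 - k = (x i - k) + 1 by ring, ZMod.val_add, ZMod.val_one, Nat.mod_eq_of_lt]
    omega
  -- a link `(y, a)` pulls back to a temporal link iff `a = i`; its time coordinate is `yᵢ − k`
  have hedge : ∀ (y : Site 4 L) (a : Fin 4),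
      (a = i → (y i - k).val < L / 2) → (a ≠ i → (y i - k).val ≤ L / 2) →
      WilsonSiteRP.IsSitePosEdge ((sitePerm (Equiv.swap 0 i).symm (y - Pi.single i k),
          (Equiv.swap 0 i).symm a) : Edge 4 L) ∨
        WilsonSiteRP.IsSharedEdge ((sitePerm (Equiv.swap 0 i).symm (y - Pi.single i k),
          (Equiv.swap 0 i).symm a) : Edge 4 L) := by
    intro y a h1 h2
    have ht : (sitePerm (Equiv.swap (0 : Fin 4) i).symm (y - Pi.single i k)) 0 = y i - k := by
      simp [sitePerm_apply]
    by_cases hai : a = i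
    · left
      have ha0 : (Equiv.swap (0 : Fin 4) i).symm a = 0 := by
        rw [Equiv.symm_swap, hai, Equiv.swap_apply_right]
      simp only [WilsonSiteRP.IsSitePosEdge, ha0, ↓reduceIte, ht]
      exact h1 hai
    · have ha0 : (Equiv.swap (0 : Fin 4) i).symm a ≠ 0 := by
        rw [Equiv.symm_swap, Ne, swap_zero_apply_eq_zero_iff]; exact hai
      have h2' := h2 hai
      simp only [WilsonSiteRP.IsSitePosEdge, WilsonSiteRP.IsSharedEdge, ha0, ↓reduceIte, ht, Ne,
        not_false_eq_true, true_and]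
      omega
  have h10 : (1 : Fin 4) ≠ 0 := by decide
  intro U V hUV
  simp only [plaquetteHolonomy]
  rcases h01 with rfl | rfl
  · have e2 : ((x.shift 0) 0 - k).val ≤ L / 2 := by rw [WilsonRP.shift_apply_self, hval]; omega
    have e3 : ((x.shift 1) 0 - k).val < L / 2 := by
      rw [WilsonRP.shift_apply_of_ne _ h10.symm]; exact hx
    rw [hUV (x, 0) (hedge x 0 (fun _ => hx) fun h => absurd rfl h),
      hUV (x.shift 0, 1) (hedge (x.shift 0) 1 (fun h => absurd h h10) fun _ => e2),
      hUV (x.shift 1, 0) (hedge (x.shift 1) 0 (fun _ => e3) fun h => absurd rfl h),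
      hUV (x, 1) (hedge x 1 (fun h => absurd h h10) fun _ => hx.le)]
  · have e2 : ((x.shift 1) 1 - k).val ≤ L / 2 := by rw [WilsonRP.shift_apply_self, hval]; omega
    have e3 : ((x.shift 0) 1 - k).val < L / 2 := by
      rw [WilsonRP.shift_apply_of_ne _ h10]; exact hx
    rw [hUV (x, 0) (hedge x 0 (fun h => absurd h h10.symm) fun _ => hx.le),
      hUV (x.shift 0, 1) (hedge (x.shift 0) 1 (fun _ => e3) fun h => absurd rfl h),
      hUV (x.shift 1, 0) (hedge (x.shift 1) 0 (fun h => absurd h h10.symm) fun _ => e2),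
      hUV (x, 1) (hedge x 1 (fun _ => hx) fun h => absurd rfl h)]

omit [NeZero L] [CompactSpace G] in
/-- The `01`-plaquette function `U ↦ Re tr ρ(U_{(x;0,1)})` is measurable. [folklore] -/
theorem measurable_re_tr_plaq01 (hρ : Continuous ρ) (x : Site 4 L) :
    Measurable fun U : GaugeConfig 4 L G => (ρ (plaquetteHolonomy U x 0 1)).trace.re :=
  WilsonRP.measurable_plaqRe ρ hρ ((x, ⟨((0 : Fin 4), (1 : Fin 4)), by decide⟩) : Plaquette 4 L)

/-- **RPCS, transverse directions** (`i ∉ {0, 1}`, `L` even, `β ≥ 0`): the product reflection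
Cauchy–Schwarz inequality for `ψ(S) = E[∏_{x∈S} f(N − Re tr ρ(U_{(x;0,1)}))]` and the cell
reflection `cellReflect i k`, from the transported link reflection. [folklore] -/
theorem rpcs_link (hL : Even L) (hρ : Continuous ρ) {β : ℝ} (hβ : 0 ≤ β) {i : Fin 4} (hi0 : i ≠ 0)
    (hi1 : i ≠ 1) (k : ZMod L) {f : ℝ → ℝ} (hfm : Measurable f) {M : ℝ} (hfb : ∀ t, |f t| ≤ M)
    (S : Finset (Site 4 L)) :
    (∫ U, ∏ x ∈ S, f ((N : ℝ) - (ρ (plaquetteHolonomy U x 0 1)).trace.re)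
        ∂(wilsonMeasure (d := 4) (L := L) ρ β)) ^ 2 ≤
      (∫ U, ∏ x ∈ (S ∩ halfPlus L i k ∪ (S ∩ halfPlus L i k).image (cellReflect i k)),
          f ((N : ℝ) - (ρ (plaquetteHolonomy U x 0 1)).trace.re)
        ∂(wilsonMeasure (d := 4) (L := L) ρ β)) *
      ∫ U, ∏ x ∈ (S ∩ halfMinus L i k ∪ (S ∩ halfMinus L i k).image (cellReflect i k)),
          f ((N : ℝ) - (ρ (plaquetteHolonomy U x 0 1)).trace.re)
        ∂(wilsonMeasure (d := 4) (L := L) ρ β) := by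
  haveI := isProbabilityMeasure_wilsonMeasure (d := 4) (L := L) ρ hρ β
  set π : Equiv.Perm (Fin 4) := Equiv.swap 0 i with hπ
  set v : Site 4 L := Pi.single i (k - 1) with hv
  set E : Set (Edge 4 L) :=
    {e : Edge 4 L | WilsonRP.IsPosEdge ((sitePerm π.symm (e.1 - v), π.symm e.2) : Edge 4 L)} with hE
  set g : GaugeConfig 4 L G → Site 4 L → ℝ :=
    fun U x => f ((N : ℝ) - (ρ (plaquetteHolonomy U x 0 1)).trace.re) with hg
  have hgm : ∀ x, Measurable fun U => g U x := fun x =>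
    hfm.comp (measurable_const.sub (measurable_re_tr_plaq01 ρ hρ x))
  have hgb : ∀ U x, |g U x| ≤ M := fun U x => hfb _
  have hgΘ : ∀ U x, g (torusConfigShift v (configPerm π (GaugeConfig.timeReflect (configPerm π.symm
      (torusConfigShift (-v) U))))) x = g U (cellReflect i k x) := fun U x => by
    simp only [hg, hπ, hv, plaquetteHolonomy_linkTheta hi0 hi1]
  have hgD : ∀ T : Finset (Site 4 L), T ⊆ halfPlus L i k → DependsOn (fun U => ∏ x ∈ T, g U x) E :=
    fun T hT => dependsOn_finset_prod fun x hx =>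
      dependsOn_plaq01_link hL hi0 hi1 (hT hx) fun a => f ((N : ℝ) - (ρ a).trace.re)
  have hD : ∀ (H K : GaugeConfig 4 L G → ℝ) (t : ℝ), DependsOn H E → DependsOn K E →
      DependsOn (fun U => H U + t * K U) E :=
    fun H K t hH hK => FiniteSusceptibilityWeakCoupling.RPCauchySchwarz.dependsOn_add_mul hH hK t
  have hRP : ∀ H : GaugeConfig 4 L G → ℝ, Measurable H → (∃ C : ℝ, ∀ U, |H U| ≤ C) →
      DependsOn H E → 0 ≤ ∫ U, H (torusConfigShift v (configPerm π (GaugeConfig.timeReflect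
        (configPerm π.symm (torusConfigShift (-v) U))))) * H U
          ∂(wilsonMeasure (d := 4) (L := L) ρ β) :=
    fun H hH hHb hHD => integral_linkTheta_mul_nonneg ρ hL hρ hβ π v H hH hHb hHD
  exact prod_rp_cauchySchwarz (μ := wilsonMeasure (d := 4) (L := L) ρ β)
    (D := fun H => DependsOn H E)
    (FiniteSusceptibilityWeakCoupling.RPCauchySchwarz.measurable_theta π v)
    (FiniteSusceptibilityWeakCoupling.RPCauchySchwarz.map_theta ρ hρ β π v)
    (FiniteSusceptibilityWeakCoupling.RPCauchySchwarz.theta_theta π v) hRP hD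
    (cellReflect i k) (cellReflect_cellReflect i k) (halfPlus L i k) (halfMinus L i k)
    (disjoint_halfPlus_halfMinus i k) (mem_halfPlus_or_mem_halfMinus i k)
    (fun x hx => cellReflect_mem_halfMinus hL hx) (fun x hx => cellReflect_mem_halfPlus hL hx)
    g hgm hgb hgΘ hgD S

/-- **RPCS, in-plane directions** (`i ∈ {0, 1}`, `L` even, any `β`): the product reflection
Cauchy–Schwarz inequality for `ψ(S) = E[∏_{x∈S} f(N − Re tr ρ(U_{(x;0,1)}))]` and the cell
reflection `cellReflect i k`, from the transported site reflection. [folklore] -/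
theorem rpcs_site (hL : Even L) (hρ : Continuous ρ) (β : ℝ) {i : Fin 4} (h01 : i = 0 ∨ i = 1)
    (k : ZMod L) {f : ℝ → ℝ} (hfm : Measurable f) {M : ℝ} (hfb : ∀ t, |f t| ≤ M)
    (S : Finset (Site 4 L)) :
    (∫ U, ∏ x ∈ S, f ((N : ℝ) - (ρ (plaquetteHolonomy U x 0 1)).trace.re)
        ∂(wilsonMeasure (d := 4) (L := L) ρ β)) ^ 2 ≤
      (∫ U, ∏ x ∈ (S ∩ halfPlus L i k ∪ (S ∩ halfPlus L i k).image (cellReflect i k)),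
          f ((N : ℝ) - (ρ (plaquetteHolonomy U x 0 1)).trace.re)
        ∂(wilsonMeasure (d := 4) (L := L) ρ β)) *
      ∫ U, ∏ x ∈ (S ∩ halfMinus L i k ∪ (S ∩ halfMinus L i k).image (cellReflect i k)),
          f ((N : ℝ) - (ρ (plaquetteHolonomy U x 0 1)).trace.re)
        ∂(wilsonMeasure (d := 4) (L := L) ρ β) := by
  haveI := isProbabilityMeasure_wilsonMeasure (d := 4) (L := L) ρ hρ β
  set π : Equiv.Perm (Fin 4) := Equiv.swap 0 i with hπ
  set v : Site 4 L := Pi.single i k with hv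
  set E : Set (Edge 4 L) :=
    {e : Edge 4 L |
      WilsonSiteRP.IsSitePosEdge ((sitePerm π.symm (e.1 - v), π.symm e.2) : Edge 4 L) ∨
        WilsonSiteRP.IsSharedEdge ((sitePerm π.symm (e.1 - v), π.symm e.2) : Edge 4 L)} with hE
  set g : GaugeConfig 4 L G → Site 4 L → ℝ :=
    fun U x => f ((N : ℝ) - (ρ (plaquetteHolonomy U x 0 1)).trace.re) with hg
  have hgm : ∀ x, Measurable fun U => g U x := fun x =>
    hfm.comp (measurable_const.sub (measurable_re_tr_plaq01 ρ hρ x))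
  have hgb : ∀ U x, |g U x| ≤ M := fun U x => hfb _
  have hgΘ : ∀ U x, g (torusConfigShift v (configPerm π (GaugeConfig.negReflect (configPerm π.symm
      (torusConfigShift (-v) U))))) x = g U (cellReflect i k x) := fun U x => by
    simp only [hg, hπ, hv, re_tr_plaquetteHolonomy_siteTheta ρ hρ h01]
  have hgD : ∀ T : Finset (Site 4 L), T ⊆ halfPlus L i k → DependsOn (fun U => ∏ x ∈ T, g U x) E :=
    fun T hT => dependsOn_finset_prod fun x hx =>
      dependsOn_plaq01_site hL h01 (hT hx) fun a => f ((N : ℝ) - (ρ a).trace.re)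
  have hD : ∀ (H K : GaugeConfig 4 L G → ℝ) (t : ℝ), DependsOn H E → DependsOn K E →
      DependsOn (fun U => H U + t * K U) E :=
    fun H K t hH hK => FiniteSusceptibilityWeakCoupling.RPCauchySchwarz.dependsOn_add_mul hH hK t
  have hRP : ∀ H : GaugeConfig 4 L G → ℝ, Measurable H → (∃ C : ℝ, ∀ U, |H U| ≤ C) →
      DependsOn H E → 0 ≤ ∫ U, H (torusConfigShift v (configPerm π (GaugeConfig.negReflect
        (configPerm π.symm (torusConfigShift (-v) U))))) * H U
          ∂(wilsonMeasure (d := 4) (L := L) ρ β) :=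
    fun H hH hHb hHD => integral_siteTheta_mul_nonneg ρ hL hρ β π v H hH hHb hHD
  exact prod_rp_cauchySchwarz (μ := wilsonMeasure (d := 4) (L := L) ρ β)
    (D := fun H => DependsOn H E) (measurable_siteTheta π v) (map_siteTheta ρ hL hρ β π v)
    (siteTheta_siteTheta π v) hRP hD
    (cellReflect i k) (cellReflect_cellReflect i k) (halfPlus L i k) (halfMinus L i k)
    (disjoint_halfPlus_halfMinus i k) (mem_halfPlus_or_mem_halfMinus i k)
    (fun x hx => cellReflect_mem_halfMinus hL hx) (fun x hx => cellReflect_mem_halfPlus hL hx)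
    g hgm hgb hgΘ hgD S

end Plaquettes

end Summit.QuantumFields.YangMills.Theorems.FemtoCurvatureTwoPoint.PlaquetteProductRPCS

namespace Summit.QuantumFields.YangMills.Theorems.FemtoCurvatureTwoPoint

open PlaquetteProductRPCS Literature.Barriers.CriticalPhenomena.NonGibbs in
/-- **Stub RPCS — reflection Cauchy–Schwarz for products of `01`-plaquette observables** (line
`generic-step-gamma-encoding` of crux `FemtoCurvatureTwoPoint`, registered signature verbatim). On
an even torus `(ℤ/L)⁴`, for every compact group `G`, continuous `ρ`, `β ≥ 0`, bounded measurable
`f ≥ 0` and `ψ(S) = E_{L,β}[∏_{x∈S} f(N − Re tr ρ(U_{(x;0,1)}))]`: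
`ψ(S)² ≤ ψ(symP i k S) ψ(symM i k S)` for every direction `i` and every `k`
(Fröhlich–Israel–Lieb–Simon 1978; Friedli–Velenik Thm. 10.11, reflection-positivity step): link
reflections for the two directions transverse to the `01`-plane, site reflections for the two
in-plane directions. [folklore] -/
theorem stub_plaquetteProductRPCS :
    ∀ (G : Type) [Group G] [TopologicalSpace G] [IsTopologicalGroup G] [CompactSpace G]
        [MeasurableSpace G] [BorelSpace G] (N : ℕ) (ρ : G →* Matrix (Fin N) (Fin N) ℂ),
      Continuous ρ → (∀ g, ρ g ∈ Matrix.unitaryGroup (Fin N) ℂ) →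
      ∀ (L : ℕ) [NeZero L], Even L → ∀ (β : ℝ), 0 ≤ β →
      ∀ (f : ℝ → ℝ), Measurable f → (∀ t, 0 ≤ f t) → (∃ M : ℝ, ∀ t, f t ≤ M) →
      ∀ (ψ : Finset (Fin 4 → ZMod L) → ℝ),
        (ψ = fun S => wilsonExpectation (d := 4) (L := L) ρ β
          (fun U => ∏ x ∈ S, f ((N : ℝ) - (ρ (plaquetteHolonomy U x 0 1)).trace.re))) →
        ∀ (i : Fin 4) (k : ZMod L) (S : Finset (Fin 4 → ZMod L)),
          ψ S ^ 2 ≤ ψ (symP i k S) * ψ (symM i k S) := by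
  intro G _ _ _ _ _ _ N ρ hρ _ L _ hL β hβ f hfm hf0 hfM ψ hψ i k S
  obtain ⟨M, hM⟩ := hfM
  have hfb : ∀ t, |f t| ≤ M := fun t => by rw [abs_of_nonneg (hf0 t)]; exact hM t
  subst hψ
  simp only [wilsonExpectation, symP, symM]
  rcases em (i = 0 ∨ i = 1) with h01 | h01
  · exact rpcs_site ρ hL hρ β h01 k hfm hfb S
  · exact rpcs_link ρ hL hρ hβ (fun h => h01 (Or.inl h)) (fun h => h01 (Or.inr h)) k hfm hfb S

end Summit.QuantumFields.YangMills.Theorems.FemtoCurvatureTwoPoint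

end
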